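import Literature.Computability.MetaComplexity.DepthFregeSequents
import HarnessLib

/-!
# Bounded completeness of the one-sided sequent toolkit `DepthFrege.Sq` and a "small step" rule

Support file for item `stmt-PneNP-11444` (`LinearGeneratorModPFregeHard`, the `AC⁰[p]`-Frege
rung of route `ExpanderLinearGenerators`), calibration line "for `p = 2` the rung fails: `MOD₂`
gates sum the certificate rows in polynomial size".  That construction (files `…Mod2*.lean`) is a
long chain of CONSTANT-SIZE propositional inferences between formulas whose `MOD₂` subformulas are
treated as atoms; this file supplies the two generic tools it runs on, on top of the sequent
judgement `DepthFrege.Sq Q t L` ("`⋁L` has a `textbookFrege` derivation of `≤ t·κ` admissible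
lines") of `DepthFregeSequents.lean`:

* `sq_complete` — **bounded completeness of the cut-free Tait calculus**: a tautological sequent
  `L` of base formulas with `Σ_{A ∈ L} |A|² ≤ N` is `Sq`-derivable with `t ≤ 2^(N+2) - 2`
  (invert the top connective of any member of size `≥ 3` — every inversion lowers `Σ |A|²` —;
  a tautological sequent of members of size `≤ 2`, i.e. of literals and (negated) constants,
  contains `x, ¬x`, or `⊤`, or `¬⊥` and is an axiom, `sq_of_small`);
* `sq_step` — **the small-step rule**: if `G` follows semantically from derived facts `F₁,…,F_a`
  (each given as `Sq Q t (Fᵢ :: K)`) and from the falsity of some members `C₁,…,C_b` of the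
  context `K` (e.g. `Cⱼ = ¬Hⱼ` for a hypothesis `Hⱼ`), then `Sq Q (2^(N+2) + a·(t+2)) (G :: K)`,
  `N ≥ Σ|·|²` over the small sequent `¬F₁,…,¬F_a, C₁,…,C_b, G` (completeness, weakening into
  `K`, then `a` cuts against the facts).

Sources: J. R. Shoenfield, *Mathematical Logic* (1967), §3.1 (the tautology theorem, whose proof
is this inversion procedure); the line/size bookkeeping is that of `DepthFregeSequents.lean`
(folklore).  No definitions are introduced.
-/

set_option linter.dupNamespace false -- `Summit.PneNP.PneNP.…`: summit = sub-problem (D-0017)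

namespace Summit.PneNP.PneNP.Theorems.ModTwo

open Literature.Computability.Complexity Literature.Computability.Complexity.PropForm
open Literature.Computability.MetaComplexity Literature.Computability.MetaComplexity.DepthFrege
open Literature.Computability.MetaComplexity.TextbookFrege (disjList disjList_nil disjList_cons)

/-! ### Tautological sequents, read memberwise, and inversion of the Tait rules -/

/-- A one-sided sequent `L` is a tautology when `⋁L` (`TextbookFrege.disjList L`) is
(`PropForm.IsTautology`), i.e. under every assignment some member is true. [Shoenfield 1967, §3.1]
[folklore] -/
theorem ltaut_iff {L : List (PropForm ℕ)} :
    (disjList L).IsTautology ↔ ∀ σ : ℕ → Bool, ∃ A ∈ L, A.eval σ = true :=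
  ⟨fun h σ => (TextbookFrege.eval_disjList σ L).1 (h σ),
    fun h σ => (TextbookFrege.eval_disjList σ L).2 (h σ)⟩

/-- Inversion of the five Tait rules on tautological sequents (`∨`, `∧` left/right, `¬¬`, `¬∨`
left/right, `¬∧`): the premises of a tautological conclusion are tautological.
[Shoenfield 1967, §3.1] [folklore] -/
theorem ltaut_invert {L : List (PropForm ℕ)} (B C : PropForm ℕ) :
    ((disjList (disj B C :: L)).IsTautology → (disjList (B :: C :: L)).IsTautology) ∧
    ((disjList (conj B C :: L)).IsTautology →
      (disjList (B :: L)).IsTautology ∧ (disjList (C :: L)).IsTautology) ∧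
    ((disjList (neg (neg B) :: L)).IsTautology → (disjList (B :: L)).IsTautology) ∧
    ((disjList (neg (disj B C) :: L)).IsTautology →
      (disjList (neg B :: L)).IsTautology ∧ (disjList (neg C :: L)).IsTautology) ∧
    ((disjList (neg (conj B C) :: L)).IsTautology →
      (disjList (neg B :: neg C :: L)).IsTautology) := by
  refine ⟨fun h => ?_, fun h => ⟨?_, ?_⟩, fun h => ?_, fun h => ⟨?_, ?_⟩, fun h => ?_⟩ <;>
    refine ltaut_iff.2 fun σ => ?_ <;>
    obtain ⟨A, hA, e⟩ := ltaut_iff.1 h σ <;>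
    rcases List.mem_cons.1 hA with rfl | hA
  · simp only [eval, Bool.or_eq_true] at e
    rcases e with e | e
    · exact ⟨B, by simp, e⟩
    · exact ⟨C, by simp, e⟩
  · exact ⟨A, by simp [hA], e⟩
  · simp only [eval, Bool.and_eq_true] at e
    exact ⟨B, by simp, e.1⟩
  · exact ⟨A, by simp [hA], e⟩
  · simp only [eval, Bool.and_eq_true] at e
    exact ⟨C, by simp, e.2⟩
  · exact ⟨A, by simp [hA], e⟩
  · simp only [eval, Bool.not_not] at e
    exact ⟨B, by simp, e⟩
  · exact ⟨A, by simp [hA], e⟩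
  · simp only [eval, Bool.not_eq_true', Bool.or_eq_false_iff] at e
    exact ⟨neg B, by simp, by simp [eval, e.1]⟩
  · exact ⟨A, by simp [hA], e⟩
  · simp only [eval, Bool.not_eq_true', Bool.or_eq_false_iff] at e
    exact ⟨neg C, by simp, by simp [eval, e.2]⟩
  · exact ⟨A, by simp [hA], e⟩
  · simp only [eval, Bool.not_eq_true', Bool.and_eq_false_iff] at e
    rcases e with e | e
    · exact ⟨neg B, by simp, by simp [eval, e]⟩
    · exact ⟨neg C, by simp, by simp [eval, e]⟩
  · exact ⟨A, by simp [hA], e⟩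

/-! ### Bounded completeness -/

section Complete

variable {Q : SPrm}

/-- **Axiom case.** A tautological sequent of base formulas of size `≤ 2` (literals, constants,
negated constants) is an axiom of the calculus: it contains a complementary pair `x, ¬x`, or `⊤`,
or `¬⊥` (otherwise the assignment "`x ↦ [¬x ∈ L]`" falsifies every member).
[Shoenfield 1967, §3.1] [folklore] -/
theorem sq_of_small {L : List (PropForm ℕ)} (hlit : ∀ A ∈ L, A.size ≤ 2)
    (htaut : (disjList L).IsTautology) (hL : ∀ A ∈ L, Base Q A) (hW : L.length ≤ Q.W) :
    Sq Q 1 L := by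
  by_cases h1 : const true ∈ L
  · exact Sq.topMem hL hW h1
  by_cases h2 : neg (const false) ∈ L
  · exact Sq.negBotMem hL hW h2
  by_cases h3 : ∃ x, var x ∈ L ∧ neg (var x) ∈ L
  · obtain ⟨x, hx, hnx⟩ := h3
    exact Sq.ax hL hW hx hnx
  exfalso
  obtain ⟨A, hA, hAσ⟩ := ltaut_iff.1 htaut fun x => decide (neg (var x) ∈ L)
  have hl := hlit A hA
  rcases A with x | b | B | ⟨B, C⟩ | ⟨B, C⟩
  · simp only [eval, decide_eq_true_eq] at hAσ
    exact h3 ⟨x, hA, hAσ⟩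
  · cases b
    · simp [eval] at hAσ
    · exact h1 hA
  · rcases B with x | b | B' | ⟨B', C'⟩ | ⟨B', C'⟩
    · simp only [eval, Bool.not_eq_true', decide_eq_false_iff_not] at hAσ
      exact hAσ hA
    · cases b
      · exact h2 hA
      · simp [eval] at hAσ
    · have := B'.size_pos; simp [size] at hl; omega
    · have := B'.size_pos; simp [size] at hl; omega
    · have := B'.size_pos; simp [size] at hl; omega
  · have := B.size_pos; have := C.size_pos; simp [size] at hl; omega
  · have := B.size_pos; have := C.size_pos; simp [size] at hl; omega

/-- Arithmetic of the cost recursion `f(N+1) = 2 f(N) + 2`, `f(N) = 2^(N+2) - 2`. [folklore] -/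
theorem cost_step (N : ℕ) : 2 * (2 ^ (N + 2) - 2) + 2 ≤ 2 ^ (N + 1 + 2) - 2 ∧ 4 ≤ 2 ^ (N + 2) := by
  have h4 : 4 ≤ 2 ^ (N + 2) := by
    calc (4 : ℕ) = 2 ^ 2 := by norm_num
      _ ≤ 2 ^ (N + 2) := Nat.pow_le_pow_right (by norm_num) (by omega)
  have hp : 2 ^ (N + 1 + 2) = 2 * 2 ^ (N + 2) := by
    rw [show N + 1 + 2 = (N + 2) + 1 from by omega, pow_succ]; ring
  omega

/-- **Bounded completeness of the Tait calculus `Sq`.** A tautological sequent `L` of base formulas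
with `Σ_{A ∈ L} |A|² ≤ N` and `|L| + N + 1 ≤ W` satisfies `Sq Q (2^(N+2) - 2) L`: pick a member of
size `≥ 3`, invert its top connective (the premises are again tautological, of smaller `Σ|·|²`,
at most one member longer), recurse; sequents of small members are axioms (`sq_of_small`).
[Shoenfield 1967, §3.1 (tautology theorem)] [folklore] -/
theorem sq_complete (N : ℕ) : ∀ (L : List (PropForm ℕ)), (L.map fun A => A.size ^ 2).sum ≤ N →
    (disjList L).IsTautology → (∀ A ∈ L, Base Q A) → L.length + N + 1 ≤ Q.W →
    Sq Q (2 ^ (N + 2) - 2) L := by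
  induction N with
  | zero =>
    intro L hN htaut hL hW
    have hlit : ∀ A ∈ L, A.size ≤ 2 := by
      intro A hA
      obtain ⟨L₁, L₂, rfl⟩ := List.append_of_mem hA
      have h1 : 1 ≤ A.size ^ 2 := Nat.one_le_pow _ _ A.size_pos
      simp only [List.map_append, List.map_cons, List.sum_append, List.sum_cons] at hN
      omega
    exact (sq_of_small hlit htaut hL (by omega)).mono (by norm_num)
  | succ N ih =>
    intro L hN htaut hL hW
    obtain ⟨hc, h4⟩ := cost_step N
    by_cases hred : ∀ A ∈ L, A.size ≤ 2
    · exact (sq_of_small hred htaut hL (by omega)).mono (by omega)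
    -- a member `A` of size `≥ 3`, `L = L₁ ++ A :: L₂`
    have hex : ∃ A ∈ L, 3 ≤ A.size := by
      by_contra h'
      refine hred fun A hA => ?_
      by_contra h''
      exact h' ⟨A, hA, by omega⟩
    obtain ⟨A, hA, hAl⟩ := hex
    obtain ⟨L₁, L₂, rfl⟩ := List.append_of_mem hA
    have hmem : ∀ X, X ∈ A :: (L₁ ++ L₂) ↔ X ∈ L₁ ++ A :: L₂ := by
      intro X; simp only [List.mem_cons, List.mem_append]; tauto
    have htaut' : (disjList (A :: (L₁ ++ L₂))).IsTautology :=
      TextbookFrege.isTautology_disjList_of_subset (fun X hX => (hmem X).2 hX) htaut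
    have hL' : ∀ X ∈ L₁ ++ L₂, Base Q X := fun X hX =>
      hL X (by simp only [List.mem_append] at hX ⊢; simp only [List.mem_cons]; tauto)
    have hAb : Base Q A := hL A hA
    have hW' : L₁.length + L₂.length + 1 + (N + 1) + 1 ≤ Q.W := by
      simp only [List.length_append, List.length_cons] at hW; omega
    have hN' : (L₁.map fun A => A.size ^ 2).sum + (L₂.map fun A => A.size ^ 2).sum + A.size ^ 2
        ≤ N + 1 := by
      simp only [List.map_append, List.map_cons, List.sum_append, List.sum_cons] at hN; omega
    clear hW hN
    -- it suffices to derive `A :: (L₁ ++ L₂)` with one tick to spare (for the final weakening)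
    suffices hsuff : Sq Q (2 ^ (N + 1 + 2) - 3) (A :: (L₁ ++ L₂)) by
      refine (hsuff.weaken (fun X hX => (hmem X).1 hX) hL ?_).mono ?_
      · simp only [List.length_append, List.length_cons]; omega
      · omega
    -- bookkeeping shared by all cases
    have hBm : ∀ {X : PropForm ℕ} {M : List (PropForm ℕ)}, Base Q X → (∀ Y ∈ M, Base Q Y) →
        ∀ Y ∈ X :: M, Base Q Y := by
      intro X M hX hM Y hY
      rcases List.mem_cons.1 hY with rfl | hY
      · exact hX
      · exact hM Y hY
    rcases A with x | b | B | ⟨B, C⟩ | ⟨B, C⟩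
    · simp [size] at hAl
    · simp [size] at hAl
    · rcases B with x | b | B' | ⟨B', C'⟩ | ⟨B', C'⟩
      · simp [size] at hAl
      · simp [size] at hAl
      · -- `¬¬B'`
        have e : (B'.neg.neg).size ^ 2 = B'.size ^ 2 + 4 * B'.size + 4 := by simp [size]; ring
        have h1 := ih (B' :: (L₁ ++ L₂))
          (by simp only [List.map_append, List.map_cons, List.sum_append, List.sum_cons]; omega)
          ((ltaut_invert B' B').2.2.1 htaut') (hBm hAb.of_neg.of_neg hL')
          (by simp only [List.length_cons, List.length_append]; omega)
        exact (Sq.consNegNeg h1 hAb).mono (by omega)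
      · -- `¬(B' ∧ C')`
        have e : (B'.conj C').neg.size ^ 2 =
            (B'.neg.size ^ 2 + C'.neg.size ^ 2) + 2 * (B'.size * C'.size) + 2 * B'.size +
              2 * C'.size + 2 := by
          simp [size]; ring
        have h1 := ih (neg B' :: neg C' :: (L₁ ++ L₂))
          (by simp only [List.map_append, List.map_cons, List.sum_append, List.sum_cons]; omega)
          ((ltaut_invert B' C').2.2.2.2 htaut')
          (hBm hAb.neg_of_negConj_left (hBm hAb.neg_of_negConj_right hL'))
          (by simp only [List.length_cons, List.length_append]; omega)
        exact (Sq.consNegConj h1 hAb).mono (by omega)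
      · -- `¬(B' ∨ C')`
        have e : (B'.disj C').neg.size ^ 2 =
            (B'.neg.size ^ 2 + C'.neg.size ^ 2) + 2 * (B'.size * C'.size) + 2 * B'.size +
              2 * C'.size + 2 := by
          simp [size]; ring
        have h1 := ih (neg B' :: (L₁ ++ L₂))
          (by simp only [List.map_append, List.map_cons, List.sum_append, List.sum_cons]; omega)
          ((ltaut_invert B' C').2.2.2.1 htaut').1 (hBm hAb.neg_of_negDisj_left hL')
          (by simp only [List.length_cons, List.length_append]; omega)
        have h2 := ih (neg C' :: (L₁ ++ L₂))
          (by simp only [List.map_append, List.map_cons, List.sum_append, List.sum_cons]; omega)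
          ((ltaut_invert B' C').2.2.2.1 htaut').2 (hBm hAb.neg_of_negDisj_right hL')
          (by simp only [List.length_cons, List.length_append]; omega)
        exact (Sq.consNegDisj h1 h2 hAb).mono (by omega)
    · -- `B ∧ C`
      have e : (B.conj C).size ^ 2 =
          (B.size ^ 2 + C.size ^ 2) + 2 * (B.size * C.size) + 2 * B.size + 2 * C.size + 1 := by
        simp [size]; ring
      have h1 := ih (B :: (L₁ ++ L₂))
        (by simp only [List.map_append, List.map_cons, List.sum_append, List.sum_cons]; omega)
        ((ltaut_invert B C).2.1 htaut').1 (hBm hAb.of_conj_left hL')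
        (by simp only [List.length_cons, List.length_append]; omega)
      have h2 := ih (C :: (L₁ ++ L₂))
        (by simp only [List.map_append, List.map_cons, List.sum_append, List.sum_cons]; omega)
        ((ltaut_invert B C).2.1 htaut').2 (hBm hAb.of_conj_right hL')
        (by simp only [List.length_cons, List.length_append]; omega)
      exact (Sq.consConj h1 h2 hAb).mono (by omega)
    · -- `B ∨ C`
      have e : (B.disj C).size ^ 2 =
          (B.size ^ 2 + C.size ^ 2) + 2 * (B.size * C.size) + 2 * B.size + 2 * C.size + 1 := by
        simp [size]; ring
      have h1 := ih (B :: C :: (L₁ ++ L₂))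
        (by simp only [List.map_append, List.map_cons, List.sum_append, List.sum_cons]; omega)
        ((ltaut_invert B C).1 htaut') (hBm hAb.of_disj_left (hBm hAb.of_disj_right hL'))
        (by simp only [List.length_cons, List.length_append]; omega)
      exact (Sq.consDisj h1 hAb).mono (by omega)

/-! ### The small-step rule -/

/-- Cutting away derived facts: from `⊢ ¬F₁, …, ¬F_a, G, K` and `⊢ Fᵢ, K` infer `⊢ G, K`
(`a` weakenings and cuts). [folklore] -/
theorem sq_cutFacts {K : List (PropForm ℕ)} {G : PropForm ℕ} {t : ℕ} :
    ∀ (Fs : List (PropForm ℕ)) {s : ℕ}, Sq Q s (Fs.map neg ++ G :: K) →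
      (∀ F ∈ Fs, Sq Q t (F :: K)) → Sq Q (s + Fs.length * (t + 2)) (G :: K)
  | [], s, h, _ => by simpa using h
  | F :: Fs, s, h, hFs => by
    have hF := hFs F (by simp)
    have h0 : Sq Q s (neg F :: (Fs.map neg ++ G :: K)) := by simpa using h
    have hlen := h0.length_le
    simp only [List.length_cons, List.length_append, List.length_map] at hlen
    have h1 : Sq Q (t + 1) (F :: (Fs.map neg ++ G :: K)) :=
      hF.weaken
        (by
          intro X hX
          simp only [List.mem_cons, List.mem_append] at hX ⊢
          tauto)
        (by
          intro X hX
          rcases List.mem_cons.1 hX with rfl | hX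
          · exact hF.base _ (by simp)
          · exact h0.base X (List.mem_cons_of_mem _ hX))
        (by
          simp only [List.length_cons, List.length_append, List.length_map]
          omega)
    have h2 : Sq Q (t + 1 + s + 1) (Fs.map neg ++ G :: K) := Sq.cut h1 h0
    have h3 := sq_cutFacts Fs h2 (fun F' hF' => hFs F' (by simp [hF']))
    refine h3.mono ?_
    simp only [List.length_cons, Nat.succ_mul]
    omega

/-- **The small-step rule.** Let `K` be a context of base formulas, `F₁, …, F_a` derived facts
(`Sq Q t (Fᵢ :: K)`), `C₁, …, C_b` members of `K` (whose falsity may be assumed — typically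
`Cⱼ = ¬Hⱼ` for a hypothesis `Hⱼ`), and `G` a base formula true whenever all `Fᵢ` are true and all
`Cⱼ` false.  Then `Sq Q (2^(N+2) + a·(t+2)) (G :: K)` whenever `N ≥ Σ|·|²` over the small sequent
`¬F₁,…,¬F_a,C₁,…,C_b,G`: that sequent is a tautology, hence derivable by `sq_complete`; weaken it
into `K` and cut the `¬Fᵢ` against the facts. [Shoenfield 1967, §3.1] [folklore] -/
theorem sq_step {K Fs Cs : List (PropForm ℕ)} {G : PropForm ℕ} {t N : ℕ}
    (hFs : ∀ F ∈ Fs, Sq Q t (F :: K)) (hCs : ∀ C ∈ Cs, C ∈ K)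
    (hK : ∀ A ∈ K, Base Q A) (hG : Base Q G) (hFb : ∀ F ∈ Fs, Base Q (neg F))
    (hN : ((Fs.map neg ++ Cs ++ [G]).map fun A => A.size ^ 2).sum ≤ N)
    (hW : K.length + Fs.length + Cs.length + N + 3 ≤ Q.W)
    (himp : ∀ σ : ℕ → Bool, (∀ F ∈ Fs, F.eval σ = true) → (∀ C ∈ Cs, C.eval σ = false) →
      G.eval σ = true) :
    Sq Q (2 ^ (N + 2) + Fs.length * (t + 2)) (G :: K) := by
  have htaut : (disjList (Fs.map neg ++ Cs ++ [G])).IsTautology := by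
    refine ltaut_iff.2 fun σ => ?_
    by_cases hGσ : G.eval σ = true
    · exact ⟨G, by simp, hGσ⟩
    by_cases hF : ∃ F ∈ Fs, F.eval σ = false
    · obtain ⟨F, hF, e⟩ := hF
      exact ⟨neg F, by simp [hF], by simp [eval, e]⟩
    by_cases hC : ∃ C ∈ Cs, C.eval σ = true
    · obtain ⟨C, hC, e⟩ := hC
      exact ⟨C, by simp [hC], e⟩
    exfalso
    refine hGσ (himp σ (fun F hF' => ?_) (fun C hC' => ?_))
    · cases e : F.eval σ
      · exact absurd ⟨F, hF', e⟩ hF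
      · rfl
    · cases e : C.eval σ
      · rfl
      · exact absurd ⟨C, hC', e⟩ hC
  have hsmall : Sq Q (2 ^ (N + 2) - 2) (Fs.map neg ++ Cs ++ [G]) := by
    refine sq_complete N _ hN htaut ?_ ?_
    · intro X hX
      simp only [List.mem_append, List.mem_map, List.mem_singleton] at hX
      rcases hX with (⟨F, hF, rfl⟩ | hX) | rfl
      · exact hFb F hF
      · exact hK X (hCs X hX)
      · exact hG
    · simp only [List.length_append, List.length_map, List.length_singleton]
      omega
  have h1 : Sq Q (2 ^ (N + 2) - 2 + 1) (Fs.map neg ++ G :: K) := by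
    refine hsmall.weaken ?_ ?_ ?_
    · intro X hX
      simp only [List.mem_append, List.mem_map, List.mem_cons, List.not_mem_nil, or_false] at hX ⊢
      rcases hX with (hX | hX) | rfl
      · exact Or.inl hX
      · exact Or.inr (Or.inr (hCs X hX))
      · exact Or.inr (Or.inl rfl)
    · intro X hX
      simp only [List.mem_append, List.mem_map, List.mem_cons] at hX
      rcases hX with ⟨F, hF, rfl⟩ | rfl | hX
      · exact hFb F hF
      · exact hG
      · exact hK X hX
    · simp only [List.length_append, List.length_map, List.length_cons]
      omega
  have h2 := sq_cutFacts Fs h1 hFs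
  refine h2.mono ?_
  have : 1 ≤ 2 ^ (N + 2) := Nat.one_le_two_pow
  omega

end Complete

end Summit.PneNP.PneNP.Theorems.ModTwo
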